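import Literature.NumberTheory.EllipticCurves.GreenbergVatsal2000.CharacterLambdaCertificateProofs
import HarnessLib

/-!
# Greenberg–Vatsal 2000 §3 (26)/(27) at `p = 3`: the interpolation values
# `characterLValueC 3 φ Σ₀ k`, `characterLValueD 3 ψ Σ₀ k` as EXPLICIT RATIONAL generalized-Bernoulli
# sums (THEOREMS) — the kernel-decidable form of the `λ`-certificates `hCcert` / `hDcert`

HONEST FRAMING (cell `bsd-eis`, seat `bsd-eis-x3` gen 4; FULL-BSD rank-`≤ 1` programme D-0033,
`run/shared/lean/pub/bsd-eis/README.md` §4): theorems only, no definition, no named fact; nothing is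
booked. The per-pair ANALYTIC certificates of the X3 certificate road
(`Summits/…/Additive/X3BranchResidualCountOfCharacters.lean`: `hCcert`, `hDcert` = the
`𝔽₃⟦T⟧`-orders `a`, `b` of `L_{Σ₀}(C ⊗ χ, T)`, `L_{Σ₀}(D ⊗ χ, T) mod 3`) are, by the divided-difference
kernel (`PAdicLambdaCertificateProofs.lean`, `CharacterLambdaCertificate[Zero]Proofs.lean`), finitely
many `3`-adic valuations of the values `characterLValueC/D 3 θ Σ₀ k` (`CharacterPAdicLFunctions.lean`,
GV (26)/(27) with Lang Ch. 4 Thm. 3.2). At `p = 3` every `𝔽₃`-valued character takes Teichmüller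
lifts in `{0, 1, −1}` (`teichmullerLift_three`), so these values are RATIONAL numbers. This file
rewrites them as casts of explicit rational sums whose summands are built from decidable data only
(divisibility of the summation index, the values of the SUPPLIED character, `ZMod 3` arithmetic),
so that a per-pair display evaluates them by `decide` and reads the certificate off with
`padicNorm`:

* `coe_teichmullerLift_three` — `ω₃(x) ∈ ℚ₃` is the integer `[x = 0 ↦ 0, x = 1 ↦ 1, x = 2 ↦ −1]`;
* (`B₁(x) = x − 1/2` is Mathlib's `Polynomial.bernoulli_one`; `B₂(x) = x² − x + 1/6` is the tree's
  `Literature.NumberTheory.ModularForms.bernoulli_two_eval`, `SiegelUnitsEisenstein.lean`);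
* `characterLValueC_three_eq_ratCast` — for `φ` mod `m` and a decidable predicate `P` with
  `(∃ v ∈ Σ₀, ℓ_v ∣ a) ↔ P a`:
  `characterLValueC 3 φ Σ₀ k = ↑(−(1/k)·N^{k−1}·∑_{a<N} t_k(a)·B_k(a/N))`, `N = m·3·∏_{v∈Σ₀} ℓ_v`,
  `t_k(a) = 0` if `P a` or `3 ∣ a`, else the integer lift of `φ(a)·(a⁻¹)^k ∈ 𝔽₃`;
* `quotCharacter_three_apply_natCast` — the values of the explicit quotient character
  `ψ = ω₃·φ⁻¹` of level `3m` (`Summits/…/Additive/X3BranchQuotCharacter.lean`):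
  `ψ(a) = (a mod 3)·φ(a)⁻¹` for `a` coprime to `3m`, `0` otherwise;
* `characterLValueD_three_eq_ratCast` — for `ψ` mod `d` with a value table `G : ℕ → 𝔽₃`
  (`ψ(a) = G a` for all `a : ℕ`):
  `characterLValueD 3 ψ Σ₀ k = ↑(2·(−(1/k))·(3d)^{k−1}·∑_{a<3d} u_k(a)·B_k(a/(3d)) · ∏_{v∈Σ₀}(1 − e_k(ℓ_v)·ℓ_v^{−k}))`
  with `u_k(a)` the integer lift of `(a⁻¹)^{k−1}·G(a)⁻¹` (`0` if `3 ∣ a`) and `e_k(ℓ)` that of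
  `G(ℓ)·ℓ^{k−1}`;

What this is NOT: no statement about which character acts on which line (that is the display's
line datum); no claim about `a`, `b` beyond the definitions; `p = 3` only (at `p ≥ 5` the lifts are
genuine `(p−1)`-st roots of unity and the values live in `ℚ_p`, not `ℚ`).

References: [GreenbergVatsal2000] §3 pp. 41–42 ((26), (27)); [LangCyclotomic1990] Ch. 2 §2 (B 6–B 7),
Ch. 4 §3 Thm. 3.2; [Greenberg2001PastPresent] §4 p. 356.
-/

noncomputable section

open scoped Classical

open Finset NumberField IsDedekindDomain Polynomial Literature.NumberTheory.EllipticCurves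

namespace Literature.NumberTheory.EllipticCurves.GreenbergVatsal2000

/-! ### §1 Teichmüller lifts at `p = 3`, read in `ℚ₃`, are the integers `0, ±1` -/

/-- **`ω₃(x) ∈ {0, 1, −1} ⊂ ℤ ⊂ ℚ₃`**: the Teichmüller lift at `p = 3`, coerced to `ℚ₃`, is the cast
of the integer `0` (`x = 0`), `1` (`x = 1`) or `−1` (`x = 2`). [cite: LangCyclotomic1990, Ch. 1 §2 (the Teichmüller character)] -/
theorem coe_teichmullerLift_three (x : ZMod 3) :
    ((teichmullerLift 3 x : ℤ_[3]) : ℚ_[3]) =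
      ((if x = 0 then 0 else if x = 1 then 1 else -1 : ℤ) : ℚ_[3]) := by
  rw [teichmullerLift_three]
  split_ifs <;> simp

/-! ### §2 `characterLValueC 3 φ Σ₀ k` as a rational number -/

section CSide

variable {m : ℕ} (φ : DirichletCharacter (ZMod 3) m) (S₀ : Finset (HeightOneSpectrum (𝓞 ℚ)))

/-- The depleted even twist at `p = 3`, read in `ℚ₃`, is the cast of the integer
`t_k(a) = [¬P a ∧ 3 ∤ a] · lift(φ(a)·(a⁻¹)^k)` once the `Σ₀`-divisibility condition is replaced by the
decidable predicate `P`. [cite: GreenbergVatsal2000, §3 p. 42 (Σ₀-depletion)] [cite: LangCyclotomic1990, Ch. 2 §2 (characters extended by 0)] -/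
theorem coe_depletedEvenCharacterTwist_three (k : ℕ) (P : ℕ → Prop) [DecidablePred P]
    (hP : ∀ a : ℕ, (∃ v ∈ S₀, Rat.HeightOneSpectrum.natGenerator v ∣ a) ↔ P a) (a : ℕ) :
    ((depletedEvenCharacterTwist 3 φ S₀ k a : ℤ_[3]) : ℚ_[3]) =
      ((if P a then 0 else if 3 ∣ a then 0 else
        (if φ (a : ZMod m) * ((a : ZMod 3)⁻¹) ^ k = 0 then 0
          else if φ (a : ZMod m) * ((a : ZMod 3)⁻¹) ^ k = 1 then 1 else -1) : ℤ) : ℚ_[3]) := by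
  unfold depletedEvenCharacterTwist evenCharacterTwist
  by_cases hPa : P a
  · rw [if_pos ((hP a).mpr hPa), if_pos hPa]; simp
  rw [if_neg (fun h ↦ hPa ((hP a).mp h)), if_neg hPa]
  by_cases h3 : 3 ∣ a
  · rw [if_pos h3, if_pos h3]; simp
  rw [if_neg h3, if_neg h3, coe_teichmullerLift_three]

/-- **`characterLValueC 3 φ Σ₀ k` is the cast of an explicit rational number**:
`−(1/k) · N^{k−1} · ∑_{a<N} t_k(a) · B_k(a/N)`, `N = m·3·∏_{v∈Σ₀} ℓ_v` (`depletedModulus`), with the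
integer summand `t_k` of `coe_depletedEvenCharacterTwist_three`. With `Polynomial.bernoulli_one` /
`ModularForms.bernoulli_two_eval` the right-hand side is a closed rational expression in decidable data, so a
display evaluates it by `decide`. [cite: GreenbergVatsal2000, §3 p. 41 ((26) and L_p(χωψ⁻¹,s) = L(C,χ,κ(γ)^{−s}−1))]
[cite: LangCyclotomic1990, Ch. 2 §2 (B 7) and Ch. 4 §3 Thm. 3.2] -/
theorem characterLValueC_three_eq_ratCast (k : ℕ) (P : ℕ → Prop) [DecidablePred P]
    (hP : ∀ a : ℕ, (∃ v ∈ S₀, Rat.HeightOneSpectrum.natGenerator v ∣ a) ↔ P a) :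
    characterLValueC 3 φ S₀ k =
      ((-(1 / (k : ℚ)) * ((depletedModulus 3 S₀ m : ℕ) : ℚ) ^ (k - 1) *
        ∑ a ∈ Finset.range (depletedModulus 3 S₀ m),
          ((if P a then 0 else if 3 ∣ a then 0 else
            (if φ (a : ZMod m) * ((a : ZMod 3)⁻¹) ^ k = 0 then 0
              else if φ (a : ZMod m) * ((a : ZMod 3)⁻¹) ^ k = 1 then 1 else -1) : ℤ) : ℚ) *
            (Polynomial.bernoulli k).eval ((a : ℚ) / ((depletedModulus 3 S₀ m : ℕ) : ℚ)) : ℚ) :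
        ℚ_[3]) := by
  unfold characterLValueC twistedBernoulli
  rw [Finset.sum_congr rfl (fun a _ ↦ by rw [coe_depletedEvenCharacterTwist_three φ S₀ k P hP a])]
  simp only [Rat.cast_mul, Rat.cast_neg, Rat.cast_div, Rat.cast_one, Rat.cast_natCast, Rat.cast_pow,
    Rat.cast_sum, Rat.cast_intCast, mul_assoc]

end CSide

/-! ### §3 The values of the explicit quotient character `ψ = ω₃·φ⁻¹` of level `3m` -/

section QuotCharacter

variable {m : ℕ} (φ : DirichletCharacter (ZMod 3) m)

/-- **Values of `ψ = ω₃·φ⁻¹` (level `3·m`) at natural numbers**: for `a` coprime to `3m`,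
`ψ(a) = (a mod 3)·φ(a mod m)⁻¹`; otherwise `ψ(a) = 0` — GV p. 28 "`φψ = ω`, the Teichmüller
character" read for Dirichlet characters with values in `𝔽₃` (`ω₃` read in `𝔽₃` is the tautological
character `(ℤ/3)ˣ → 𝔽₃ˣ`; `changeLevel` evaluates through `ZMod.cast`). [cite: GreenbergVatsal2000, §2 p. 28 (φψ = ω)] -/
theorem quotCharacter_three_apply_natCast (a : ℕ) :
    (DirichletCharacter.changeLevel (dvd_mul_right 3 m) (MulChar.ofUnitHom (MonoidHom.id (ZMod 3)ˣ)) *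
        DirichletCharacter.changeLevel (dvd_mul_left m 3) φ⁻¹ : DirichletCharacter (ZMod 3) (3 * m))
      (a : ZMod (3 * m)) =
      if a.Coprime (3 * m) then (a : ZMod 3) * (φ (a : ZMod m))⁻¹ else 0 := by
  by_cases hc : a.Coprime (3 * m)
  · rw [if_pos hc]
    have hu : IsUnit (a : ZMod (3 * m)) := (ZMod.isUnit_iff_coprime a (3 * m)).mpr hc
    obtain ⟨u, hu'⟩ := hu
    have h1 : (DirichletCharacter.changeLevel (dvd_mul_right 3 m)
        (MulChar.ofUnitHom (MonoidHom.id (ZMod 3)ˣ))) (u : ZMod (3 * m)) = (a : ZMod 3) := by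
      rw [DirichletCharacter.changeLevel_def, MulChar.ofUnitHom_coe, MonoidHom.comp_apply,
        MulChar.coe_toUnitHom, MulChar.ofUnitHom_coe, MonoidHom.id_apply, ZMod.unitsMap_val, hu',
        ZMod.cast_natCast (dvd_mul_right 3 m)]
    have h2 : (DirichletCharacter.changeLevel (dvd_mul_left m 3) φ⁻¹) (u : ZMod (3 * m)) =
        (φ (a : ZMod m))⁻¹ := by
      rw [DirichletCharacter.changeLevel_eq_cast_of_dvd, hu', ZMod.cast_natCast (dvd_mul_left m 3),
        MulChar.inv_apply_eq_inv']
    rw [← hu', MulChar.mul_apply, h1, h2]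
  · rw [if_neg hc]
    exact MulChar.map_nonunit _ (fun h ↦ hc ((ZMod.isUnit_iff_coprime a (3 * m)).mp h))

end QuotCharacter

/-! ### §4 `characterLValueD 3 ψ Σ₀ k` as a rational number -/

section DSide

variable {d : ℕ} (ψ : DirichletCharacter (ZMod 3) d) (S₀ : Finset (HeightOneSpectrum (𝓞 ℚ)))

/-- The odd twist at `p = 3`, read in `ℚ₃`, is the cast of the integer
`u_k(a) = [3 ∤ a] · lift((a⁻¹)^{k−1}·G(a)⁻¹)` for a value table `G` of `ψ` on `ℕ`.
[cite: GreenbergVatsal2000, §3 p. 42 ((ωψ⁻¹)ω^{−k})] [cite: LangCyclotomic1990, Ch. 2 §2 (characters extended by 0)] -/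
theorem coe_oddCharacterTwist_three (k : ℕ) (G : ℕ → ZMod 3) (hG : ∀ a : ℕ, ψ (a : ZMod d) = G a)
    (a : ℕ) :
    ((oddCharacterTwist 3 ψ k a : ℤ_[3]) : ℚ_[3]) =
      ((if 3 ∣ a then 0 else
        (if ((a : ZMod 3)⁻¹) ^ (k - 1) * (G a)⁻¹ = 0 then 0
          else if ((a : ZMod 3)⁻¹) ^ (k - 1) * (G a)⁻¹ = 1 then 1 else -1) : ℤ) : ℚ_[3]) := by
  unfold oddCharacterTwist
  by_cases h3 : 3 ∣ a
  · rw [if_pos h3, if_pos h3]; simp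
  rw [if_neg h3, if_neg h3, hG a, coe_teichmullerLift_three]

/-- The `Σ₀`-Euler factor of `L_{Σ₀}(D, T)` at `T = κ(γ)^{1−k} − 1`, read in `ℚ₃`, is the cast of the
rational number `1 − e_k(ℓ)·ℓ^{−k}`, `e_k(ℓ) = lift(G(ℓ)·ℓ^{k−1})`. [cite: GreenbergVatsal2000, §3 p. 42 (the Euler factors 1 − χψ(l)l⁻¹(1+T)^{f_l})] -/
theorem coe_eulerFactorD_three (k : ℕ) (G : ℕ → ZMod 3) (hG : ∀ a : ℕ, ψ (a : ZMod d) = G a)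
    (ℓ : ℕ) :
    (1 - ((teichmullerLift 3 (ψ (ℓ : ZMod d)) * teichmullerLift 3 (ℓ : ZMod 3) ^ (k - 1) : ℤ_[3]) :
        ℚ_[3]) * ((ℓ : ℚ_[3])⁻¹) ^ k) =
      ((1 - ((if G ℓ * (ℓ : ZMod 3) ^ (k - 1) = 0 then 0
          else if G ℓ * (ℓ : ZMod 3) ^ (k - 1) = 1 then 1 else -1 : ℤ) : ℚ) * ((ℓ : ℚ)⁻¹) ^ k : ℚ) :
        ℚ_[3]) := by
  rw [hG ℓ, ← teichmullerLift_pow, ← teichmullerLift_mul, coe_teichmullerLift_three]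
  simp only [Rat.cast_sub, Rat.cast_one, Rat.cast_mul, Rat.cast_intCast, Rat.cast_pow, Rat.cast_inv,
    Rat.cast_natCast]

/-- **`characterLValueD 3 ψ Σ₀ k` is the cast of an explicit rational number**:
`2·(−(1/k))·(3d)^{k−1}·∑_{a<3d} u_k(a)·B_k(a/(3d)) · ∏_{v∈Σ₀} (1 − e_k(ℓ_v)·ℓ_v^{−k})` for a value
table `G` of `ψ` (`ψ(a) = G(a)` on `ℕ`; for the quotient character of the X3 road use
`quotCharacter_three_apply_natCast`). A display evaluates the right-hand side by `decide` after
rewriting its explicit `Σ₀`. [cite: GreenbergVatsal2000, §3 p. 42 ((27) and L_p(ωχ⁻¹ψ⁻¹,s) = ½L(D,χ,κ(γ)^s−1))]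
[cite: LangCyclotomic1990, Ch. 2 §2 (B 7) and Ch. 4 §3 Thm. 3.2] -/
theorem characterLValueD_three_eq_ratCast (k : ℕ) (G : ℕ → ZMod 3)
    (hG : ∀ a : ℕ, ψ (a : ZMod d) = G a) :
    characterLValueD 3 ψ S₀ k =
      (((2 * (-(1 / (k : ℚ)) * (((d * 3 : ℕ) : ℚ) ^ (k - 1) *
          ∑ a ∈ Finset.range (d * 3),
            ((if 3 ∣ a then 0 else
              (if ((a : ZMod 3)⁻¹) ^ (k - 1) * (G a)⁻¹ = 0 then 0
                else if ((a : ZMod 3)⁻¹) ^ (k - 1) * (G a)⁻¹ = 1 then 1 else -1) : ℤ) : ℚ) *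
              (Polynomial.bernoulli k).eval ((a : ℚ) / ((d * 3 : ℕ) : ℚ))))) *
        ∏ v ∈ S₀,
          (1 - ((if G (Rat.HeightOneSpectrum.natGenerator v) *
                (Rat.HeightOneSpectrum.natGenerator v : ZMod 3) ^ (k - 1) = 0 then 0
            else if G (Rat.HeightOneSpectrum.natGenerator v) *
                (Rat.HeightOneSpectrum.natGenerator v : ZMod 3) ^ (k - 1) = 1 then 1 else -1 : ℤ) : ℚ) *
            (((Rat.HeightOneSpectrum.natGenerator v : ℕ) : ℚ)⁻¹) ^ k) : ℚ) : ℚ_[3]) := by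
  unfold characterLValueD twistedBernoulli
  rw [Finset.sum_congr rfl (fun a _ ↦ by rw [coe_oddCharacterTwist_three ψ k G hG a]),
    Finset.prod_congr rfl (fun v _ ↦ by rw [coe_eulerFactorD_three ψ k G hG])]
  simp only [Rat.cast_mul, Rat.cast_neg, Rat.cast_div, Rat.cast_one, Rat.cast_natCast, Rat.cast_pow,
    Rat.cast_sum, Rat.cast_prod, Rat.cast_intCast, Rat.cast_sub, Rat.cast_inv, Rat.cast_ofNat,
    mul_assoc]

end DSide


end Literature.NumberTheory.EllipticCurves.GreenbergVatsal2000

end
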